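import Summits.QuantumFields.BalabanUV.Beta.EriceRemainderEnclosureHistoryAutonomyComparisonAgeCompositionTower16Mid
import Summits.QuantumFields.BalabanUV.Beta.EriceRemainderEnclosureHistoryAutonomyComparisonAgeCompositionYoungPairCapSeparatedAges

/-!
# EriceRemainderEnclosureHistoryAutonomyComparisonAgeCompositionTower16Every — (E106f) route (N), first order: THE RATIO-16 TOWER FOR EVERY YOUNG SECOND AGE, part 2.
# (E106d) `flow_nonneg_census_tower16` closes the census tower `{1, a_1, a_2, …}` (ratios `≥ 16`) for `a_1 ≥ 58` — the first old age must be old enough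
# for the single cap `123∕200` and the pair letters (`j ≥ 56`).  The prequel (E106e) `…Tower16Mid` and this file add the two YOUNG ENDS and the union:
# * **`flow_nonneg_census_tower16_mid`** — `30 ≤ a_1`, `a_2 ≥ 72·a_1`, ratios `≥ 16` above: levels `{1}, {a_1}, {a_2}, …` with `κ_0 := 2∕5` and the SCALED
#   overshoot `κ_1 := (58a_1∕a_2)·G₃(X_2) ≤ (58∕72)·0.233` (closure of `{a_2}` by (E106c) `row₃` at `a′ = 58a_1`, rescaled; closure of `{a_1}` by
#   `x_{a_1} ≤ 77∕125` (`a_1 ≥ 30`, (E94b)) and `4·(77∕125)(1+κ̄₁)+κ̄₁ ≤ (2∕5)(1 − (77∕125)(1+κ̄₁))·30`; young closure `0.7072·(7∕5) ≤ 1`);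
# * **`flow_nonneg_census_tower16_young_pair`** — `2 ≤ a_1 ≤ 29`, `a_2 ≥ 72·a_1`: levels `{1, a_1}, {a_2}, …` with the young-pair cap `0.8333` (E97c) and
#   `κ_0 := (58a_1∕a_2)·G₃(X_2)`: `0.8333·(1 + (58∕72)·0.233) = 0.9897 ≤ 1`;
# * **`flow_nonneg_census_tower16_every`** — EVERY `a_1 ≥ 2` once `a_2 ≥ 72·a_1` and the ratios above are `≥ 16` (the three cases).
# So: the census profile `{1, k₂, k₃, k₄, …}` with ANY number of ages holds at first order for EVERY `k₂ ≥ 2`, `k₃ ≥ 72k₂`, `k_{j+1} ≥ 16k_j` (`j ≥ 3`).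

Cell `pub-balaban`, β-function sub-cell, BINDER row D4 «RemainderConst leaves for Bałaban's split» (`HOME/BINDER-OWNERS.md`; owner lineage `b2b-balaban-beta-an4`;
this file by co-owner #2 lineage `b2b-balaban-beta-d4-p2`, generation 90), β-FLOW TEAM duty (1), FREEZE (0) honoured (def-free; nothing restated).

HONEST FRAMING (page 1, verbatim and binding).  *"Discharging BetaPertH makes Bałaban's UV stability UNCONDITIONAL — a real constructive-QFT result; it is
NOT the continuum limit and NOT the Clay problem."*  THIS FILE DISCHARGES NOTHING OF THE KIND.  Elementary real algebra ∕ real analysis about ABSTRACT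
functionals on a box ]0,γ]^ℕ with displayed floors, profiles and signs, and the FIRST-ORDER renewal objects of route (N) built from them — hypotheses of a
census, not facts; the form, signs, ages and moments of Bałaban's (1.22) limit functional are NOT PRINTED ([I] p. 298; GAPS G-t4-U2-1∕-2) and NOT asserted.
Row D4 class UNCHANGED (critical-path width 0; instance 0∕1; D4 DISCHARGE NO DATE).  HONEST DEPENDENCY: continuum YM on T⁴ ⇐ BetaPertH ∧ nine spine
estimates (0/9 proved); BetaPertH ⇐ (D1) ∧ (D4) ∧ CAP+tail; G-an2-4 gates asym, D1 and NE2/3/4.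

THE POINT (README `HOME/b2b-balaban-beta-d4-p2/g90/README.md` §3).  Uses (E101b) `flow_nonneg_adaptive_cluster_levels`, (E94b) `load_le_of_sq`, (E97c)
`young_pair_load_le`, (E106b) `closure_of_bounds`, `G₃_le`, `Mf_nonneg`, (E106c) `row₃`, (E106d) `envelope_of_next`, `tower_closure`, `flow_nonneg_census_tower16`
BY NAME.  NOT CLAIMED: `a_2 < 72a_1` for `a_1 < 58`; ratios below 16; anything printed — NOT B12 Thm 2, NOT BetaPertH, NOT continuum, NOT Clay.

WHAT IS PROVED ([folklore]; 0 `def`, 0 sorry).  §2 **`flow_nonneg_census_tower16_young_pair`**.  §3 **`flow_nonneg_census_tower16_every`** (§1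
`flow_nonneg_census_tower16_mid` is the prequel (E106e) `…Tower16Mid`).
-/
noncomputable section
open Finset

namespace Summit.QuantumFields.BalabanUV.Beta.EriceRemainderEnclosureHistoryAutonomyComparisonAgeCompositionTower16Every

open Literature.MathematicalPhysics.QuantumFieldTheory.Balaban1983to89
open Literature.MathematicalPhysics.QuantumFieldTheory.Balaban1983to89.T4BetaStationary
open Literature.MathematicalPhysics.QuantumFieldTheory.Balaban1983to89.T4BetaFlowWellPosed
open Summit.QuantumFields.BalabanUV.Beta.EriceRemainderEnclosureHistoryAutonomyComparisonAgeCompositionYoungPairMoment (load_le_of_sq)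
open Summit.QuantumFields.BalabanUV.Beta.EriceRemainderEnclosureHistoryAutonomyComparisonAgeCompositionAdaptiveLevels (flow_nonneg_adaptive_cluster_levels)
open Summit.QuantumFields.BalabanUV.Beta.EriceRemainderEnclosureHistoryAutonomyComparisonAgeCompositionYoungPairCapSeparatedAges (young_pair_load_le)
open Summit.QuantumFields.BalabanUV.Beta.EriceRemainderEnclosureHistoryAutonomyComparisonAgeCompositionTowerTable
open Summit.QuantumFields.BalabanUV.Beta.EriceRemainderEnclosureHistoryAutonomyComparisonAgeCompositionTowerTableRows (row₃)
open Summit.QuantumFields.BalabanUV.Beta.EriceRemainderEnclosureHistoryAutonomyComparisonAgeCompositionTower16 (envelope_of_next tower_closure flow_nonneg_census_tower16)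
open Summit.QuantumFields.BalabanUV.Beta.EriceRemainderEnclosureHistoryAutonomyComparisonAgeCompositionTower16Mid (flow_nonneg_census_tower16_mid)

variable {B : (ℕ → ℝ) → ℝ} {γ b gIR : ℝ} {L : ℕ → ℝ} {K : ℕ} {h g : ℕ → ℝ}

/-! ## §2 The young-pair end: `2 ≤ a_1 ≤ 29`, `a_2 ≥ 72a_1` -/

/-- **THE RATIO-16 TOWER ABOVE THE YOUNG PAIR.**  Ages `a_0 = 1 < a_1 < a_2 < …` (`r ≥ 2`) with `2 ≤ a_1 ≤ 29`, `72a_1 ≤ a_2`, `16a_j ≤ a_{j+1}` (`j ≥ 2`),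
all `< K`, the profile vanishing off them: `0 ≤ ε ≤ e` at every pin — levels `{1,a_1}, {a_2}, {a_3}, …`. [folklore] -/
theorem flow_nonneg_census_tower16_young_pair
    (hmono : ∀ u v : ℕ → ℝ, SeqBox γ u → SeqBox γ v → (∀ j, u j ≤ v j) → B u ≤ B v)
    (hL : ∀ k, 0 ≤ L k) (hb : 0 < b) (hlo : ∀ u, SeqBox γ u → b ≤ B u) (hdom : ∀ u, SeqBox γ u → ∑ k ∈ range K, L k * u k ≤ B u)
    (hh : SeqBox γ h) (hf : MemFlow B gIR h) (hg : ∀ t, 0 < g t ∧ g t ≤ 1)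
    (hgF : ∀ t, 1 ≤ g t * (1 + ∑ k ∈ range K, L k * h (t + k) ^ 3 / 2))
    {r : ℕ} {a : ℕ → ℕ} (hr : 2 ≤ r) (ha0 : a 0 = 1) (ha1 : 2 ≤ a 1) (ha29 : a 1 ≤ 29) (ha2 : 2 < r → 72 * a 1 ≤ a 2)
    (haR : ∀ j, 2 ≤ j → j + 1 < r → 16 * a j ≤ a (j + 1)) (haK : ∀ j, j < r → a j < K)
    (hLa : ∀ l, l < K → (∀ j, j < r → l ≠ a j) → L l = 0)
    {N : ℕ} {KL : ℕ → ℕ → ℕ → ℝ}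
    (hKL : ∀ k n l, KL k n l = if 0 < k ∧ k < K ∧ l < k then L k * h (n + k) ^ 3 / 2 * ∏ t ∈ Ico (n + 1 + l) (n + k + 1), g t else 0)
    {KA : ℕ → ℕ → ℕ → ℝ} {RA : ℕ → (ℕ → ℝ) → ℕ → ℝ}
    (hRA : ∀ i v m, RA i v m = ∑ l ∈ range K, KA i m l * v (m + 1 + l))
    (hKA : ∀ i m l, KA i m l = KL i m l + KA (i + 1) m l) (hKAtop : ∀ m l, KA K m l = 0)
    {e ε : ℕ → ℝ} (he0 : ∀ m, 0 ≤ e m) (hea : ∀ m, e (m + 1) ≤ e m)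
    (hεt : ∀ m, N < m → ε m = 0) (hεrec : ∀ m, ε m = e m - RA 1 ε m) : ∀ m, 0 ≤ ε m ∧ ε m ≤ e m := by
  have hpos : ∀ n, 0 < h n := fun n => (hh n).1
  have hK : 1 ≤ K := by have := haK 0 (by omega); omega
  have h58 : ∀ j, 2 ≤ j → j < r → 58 ≤ a j := by
    intro j hj hjr
    induction j with
    | zero => omega
    | succ i ih =>
      rcases Nat.lt_or_ge i 2 with hi2 | hi2
      · have hi1 : i = 1 := by omega
        subst hi1; show 58 ≤ a 2; have := ha2 (by omega); omega
      · have := ih hi2 (by omega); have := haR i hi2 (by omega); omega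
  have hlt : ∀ j, j + 1 < r → a j < a (j + 1) := by
    intro j hjr
    rcases Nat.lt_or_ge j 2 with hj2 | hj2
    · interval_cases j
      · show a 0 < a 1; rw [ha0]; omega
      · show a 1 < a 2; have := ha2 (by omega); omega
    · have := haR j hj2 hjr; have := h58 j hj2 (by omega); omega
  have hsm : ∀ i j, i < j → j < r → a i < a j := by
    intro i j hij hjr
    induction j with
    | zero => omega
    | succ j ih =>
      rcases Nat.lt_or_ge i j with hij' | hij'
      · exact lt_trans (ih hij' (by omega)) (hlt j hjr)
      · have : i = j := by omega
        subst this; exact hlt i hjr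
  have ha1' : ∀ j, j < r → 1 ≤ a j := by
    intro j hjr
    rcases Nat.lt_or_ge j 2 with hj2 | hj2
    · interval_cases j <;> omega
    · have := h58 j hj2 hjr; omega
  -- loads and caps
  obtain ⟨X, hX⟩ : ∃ X : ℕ → ℕ → ℝ, ∀ j q, X j q = (a j : ℝ) * (L (a j) * h (q + a j) ^ 3 / 2) := ⟨_, fun _ _ => rfl⟩
  have hX0 : ∀ j q, 0 ≤ X j q := fun j q => by rw [hX]; have := hL (a j); have := hpos (q + a j); positivity
  obtain ⟨XP, hXP⟩ : ∃ XP : ℕ → ℝ, ∀ q, XP q = L 1 * h (q + 1) ^ 3 / 2 + (a 1 : ℝ) * (L (a 1) * h (q + a 1) ^ 3 / 2) := ⟨_, fun _ => rfl⟩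
  have hXP0 : ∀ q, 0 ≤ XP q := fun q => by
    rw [hXP]; have := hL 1; have := hL (a 1); have := hpos (q + 1); have := hpos (q + a 1); positivity
  have hXPc : ∀ q, XP q ≤ 8333 / 10000 := fun q => by
    rw [hXP]; exact young_pair_load_le hmono hL hb hlo hdom hh hf ha1 ha29 (haK 1 (by omega)) q
  have hXc : ∀ j q, 2 ≤ j → j < r → X j q ≤ 123 / 200 := fun j q hj hjr => by
    rw [hX]
    have h58j : (58 : ℝ) ≤ a j := by exact_mod_cast h58 j hj hjr
    exact load_le_of_sq hmono hL hb hlo hdom hh hf (ha1' j hjr) (haK j hjr) (so := 123 / 200) (by norm_num) (by nlinarith [h58j]) q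
  -- THE TABLE (E106b) and the overshoots of the levels {1,a_1}, {a_2}, {a_3}, … (indexed j = 0, 1, 2, …)
  obtain ⟨G₁, hG₁⟩ : ∃ G₁ : ℝ → ℝ, ∀ x, G₁ x = if x ≤ 7 / 25 then if x ≤ 4 / 25 then if x ≤ 3 / 25 then if x ≤ 2 / 25 then if x ≤ 1 / 25 then 77 / 1000 else 53 / 500 else 139 / 1000 else if x ≤ 7 / 50 then 159 / 1000 else 9 / 50 else if x ≤ 1 / 5 then if x ≤ 37 / 200 then 193 / 1000 else 211 / 1000 else if x ≤ 6 / 25 then 219 / 1000 else 231 / 1000 else if x ≤ 12 / 25 then if x ≤ 2 / 5 then if x ≤ 9 / 25 then if x ≤ 8 / 25 then 257 / 1000 else 289 / 1000 else 163 / 500 else if x ≤ 11 / 25 then 37 / 100 else 421 / 1000 else if x ≤ 14 / 25 then if x ≤ 13 / 25 then 61 / 125 else 121 / 200 else if x ≤ 3 / 5 then 767 / 1000 else 169 / 200 := ⟨_, fun _ => rfl⟩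
  obtain ⟨G₂, hG₂⟩ : ∃ G₂ : ℝ → ℝ, ∀ x, G₂ x = if x ≤ 7 / 25 then if x ≤ 4 / 25 then if x ≤ 3 / 25 then if x ≤ 2 / 25 then if x ≤ 1 / 25 then 39 / 1000 else 53 / 1000 else 7 / 100 else if x ≤ 7 / 50 then 2 / 25 else 9 / 100 else if x ≤ 1 / 5 then if x ≤ 37 / 200 then 97 / 1000 else 53 / 500 else if x ≤ 6 / 25 then 11 / 100 else 29 / 250 else if x ≤ 12 / 25 then if x ≤ 2 / 5 then if x ≤ 9 / 25 then if x ≤ 8 / 25 then 129 / 1000 else 29 / 200 else 163 / 1000 else if x ≤ 11 / 25 then 37 / 200 else 211 / 1000 else if x ≤ 14 / 25 then if x ≤ 13 / 25 then 61 / 250 else 303 / 1000 else if x ≤ 3 / 5 then 48 / 125 else 423 / 1000 := ⟨_, fun _ => rfl⟩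
  obtain ⟨G₃, hG₃⟩ : ∃ G₃ : ℝ → ℝ, ∀ x, G₃ x = if x ≤ 7 / 25 then if x ≤ 4 / 25 then if x ≤ 3 / 25 then if x ≤ 2 / 25 then if x ≤ 1 / 25 then 11 / 500 else 3 / 100 else 39 / 1000 else if x ≤ 7 / 50 then 11 / 250 else 1 / 20 else if x ≤ 1 / 5 then if x ≤ 37 / 200 then 27 / 500 else 59 / 1000 else if x ≤ 6 / 25 then 61 / 1000 else 8 / 125 else if x ≤ 12 / 25 then if x ≤ 2 / 5 then if x ≤ 9 / 25 then if x ≤ 8 / 25 then 71 / 1000 else 2 / 25 else 9 / 100 else if x ≤ 11 / 25 then 51 / 500 else 117 / 1000 else if x ≤ 14 / 25 then if x ≤ 13 / 25 then 27 / 200 else 167 / 1000 else if x ≤ 3 / 5 then 53 / 250 else 233 / 1000 := ⟨_, fun _ => rfl⟩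
  obtain ⟨Mf, hM⟩ : ∃ Mf : ℝ → ℝ, ∀ x, Mf x = if x < 8 / 25 then if x < 6 / 25 then if x < 1 / 5 then if x < 4 / 25 then 169 / 200 else 767 / 1000 else 121 / 200 else if x < 7 / 25 then 61 / 125 else 421 / 1000 else if x < 11 / 25 then if x < 2 / 5 then if x < 9 / 25 then 37 / 100 else 163 / 500 else 289 / 1000 else if x < 12 / 25 then 257 / 1000 else 233 / 1000 := ⟨_, fun _ => rfl⟩
  obtain ⟨T, hT⟩ : ∃ T : ℕ → ℕ → ℝ → ℝ, ∀ lo hi x, T lo hi x = if 58 * lo ≤ hi then G₃ x else if 32 * lo < hi then G₂ x else G₁ x :=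
    ⟨_, fun _ _ _ => rfl⟩
  have hT0 : ∀ lo hi x, 0 ≤ T lo hi x := fun lo hi x => by
    rw [hT]; split_ifs
    exacts [G₃_nonneg hG₃ x, G₂_nonneg hG₂ x, G₁_nonneg hG₁ x]
  obtain ⟨κ, hκ⟩ : ∃ κ : ℕ → ℕ → ℝ, ∀ j q, κ j q = if j = 0 then (if 2 < r then 58 * (a 1 : ℝ) / (a 2 : ℝ) * G₃ (X 2 q) else 0)
      else (if j + 2 < r then T (a (j + 1)) (a (j + 2)) (X (j + 2) q) else 0) := ⟨_, fun _ _ => rfl⟩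
  have hκ0b : ∀ q, 0 ≤ κ 0 q ∧ κ 0 q ≤ 6757 / 36000 := by
    intro q
    rw [hκ, if_pos rfl]
    split_ifs with h2r
    · have ha1p : (0 : ℝ) < a 1 := by exact_mod_cast ha1' 1 (by omega)
      have ha2p : (0 : ℝ) < a 2 := by exact_mod_cast ha1' 2 h2r
      have h72 : 72 * (a 1 : ℝ) ≤ a 2 := by exact_mod_cast ha2 h2r
      have hG := G₃_le hG₃ (X 2 q)
      have hG0 := G₃_nonneg hG₃ (X 2 q)
      have hq : 58 * (a 1 : ℝ) / (a 2 : ℝ) ≤ 58 / 72 := by rw [div_le_iff₀ ha2p]; linarith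
      have hq0 : 0 ≤ 58 * (a 1 : ℝ) / (a 2 : ℝ) := by positivity
      constructor
      · positivity
      · calc 58 * (a 1 : ℝ) / (a 2 : ℝ) * G₃ (X 2 q) ≤ 58 / 72 * (233 / 1000) := mul_le_mul hq hG hG0 (by norm_num)
          _ = 6757 / 36000 := by norm_num
    · exact ⟨le_rfl, by norm_num⟩
  have hκ0 : ∀ j q, 0 ≤ κ j q := by
    intro j q
    rcases Nat.eq_zero_or_pos j with hj0 | hj0
    · subst hj0; exact (hκ0b q).1
    · rw [hκ, if_neg (by omega)]
      split_ifs
      exacts [hT0 _ _ _, le_rfl]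
  -- LEMMA A for the tower levels j ≥ 1 (ages a_(j+1) ≥ 58)
  have hA : ∀ j q, 1 ≤ j → j + 1 < r → κ j q ≤ Mf (X (j + 1) q) := by
    intro j q hj hjr
    rw [hκ, if_neg (by omega)]
    split_ifs with hj2
    · rw [hT, hX, hX]
      exact envelope_of_next hmono hL hb hlo hdom hh hf hG₁ hG₂ hG₃ hM (le_trans (by norm_num) (h58 (j + 1) (by omega) hjr))
        (haR (j + 1) (by omega) hj2) (haK (j + 2) hj2) q
    · rw [hX]; exact Mf_nonneg hM _
  -- THE ENGINE (E101b) with r − 1 levels: the young pair, then singletons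
  obtain ⟨S, hS⟩ : ∃ S : ℕ → Finset ℕ, ∀ j, S j = if j = 0 then {1, a 1} else {a (j + 1)} := ⟨_, fun _ => rfl⟩
  obtain ⟨lo, hlo'⟩ : ∃ lo : ℕ → ℕ, ∀ j, lo j = if j = 0 then 1 else a (j + 1) := ⟨_, fun _ => rfl⟩
  have hS0 : S 0 = {1, a 1} := by rw [hS, if_pos rfl]
  have hSj : ∀ j, 1 ≤ j → S j = {a (j + 1)} := fun j hj => by rw [hS, if_neg (by omega)]
  have h1ne : (1 : ℕ) ≠ a 1 := by omega
  have hsum0 : ∀ q, ∑ k ∈ S 0, (k : ℝ) * (L k * h (q + k) ^ 3 / 2) = XP q := fun q => by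
    rw [hS0, sum_pair h1ne, hXP]; push_cast; ring
  have hsumj : ∀ j q, 1 ≤ j → ∑ k ∈ S j, (k : ℝ) * (L k * h (q + k) ^ 3 / 2) = X (j + 1) q := fun j q hj => by
    rw [hSj j hj, sum_singleton, hX]
  refine flow_nonneg_adaptive_cluster_levels hmono hL hb hlo hdom hh hf hg hgF hK (r := r - 1) (S := S) (lo := lo) (hi := fun j => a (j + 1))
    (κ := κ) hκ0 (fun j hj k hk => ?_) (fun j hj k hk => ?_) (fun j hj k hk => ?_) (fun j hj1 _ => ?_) (fun j hj1 hj => ?_)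
    (fun j hj => ?_) (fun i j hij hjr => ?_) (fun l hl hnot => ?_) (fun q => ?_) (fun j q hj1 hjr => ?_)
    hKL hRA hKA hKAtop he0 hea hεt hεrec
  · -- members are ages in [1, K)
    rcases Nat.eq_zero_or_pos j with hj0 | hj0
    · subst hj0; rw [hS0, mem_insert, mem_singleton] at hk
      rcases hk with hk | hk <;> subst hk
      · exact ⟨le_rfl, by have := haK 0 (by omega); rwa [ha0] at this⟩
      · exact ⟨ha1' 1 (by omega), haK 1 (by omega)⟩
    · rw [hSj j hj0, mem_singleton] at hk; subst hk; exact ⟨ha1' (j + 1) (by omega), haK (j + 1) (by omega)⟩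
  · -- lo j ≤ members
    rcases Nat.eq_zero_or_pos j with hj0 | hj0
    · subst hj0; rw [hlo', if_pos rfl]; rw [hS0, mem_insert, mem_singleton] at hk
      rcases hk with hk | hk <;> subst hk
      exacts [le_rfl, ha1' 1 (by omega)]
    · rw [hSj j hj0, mem_singleton] at hk; subst hk; rw [hlo', if_neg (by omega)]
  · -- members ≤ hi j
    rcases Nat.eq_zero_or_pos j with hj0 | hj0
    · subst hj0; rw [hS0, mem_insert, mem_singleton] at hk
      rcases hk with hk | hk <;> subst hk
      exacts [ha1' 1 (by omega), le_rfl]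
    · rw [hSj j hj0, mem_singleton] at hk; subst hk; exact le_rfl
  · rw [hlo', if_neg (by omega)]
  · rw [hlo', if_neg (by omega)]; exact ha1' (j + 1) (by omega)
  · -- nested: a (j+1) ≤ lo (j+1) = a (j+2)
    rw [hlo', if_neg (by omega)]; exact (hlt (j + 1) (by omega)).le
  · -- disjoint levels
    rcases Nat.eq_zero_or_pos i with hi0 | hi0
    · subst hi0
      rw [hS0, hSj j (by omega), disjoint_singleton_right, mem_insert, mem_singleton, not_or]
      have h1 := hsm 1 (j + 1) (by omega) (by omega)
      have h0 := hsm 0 (j + 1) (by omega) (by omega)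
      rw [ha0] at h0
      exact ⟨by omega, by omega⟩
    · rw [hSj i hi0, hSj j (by omega), disjoint_singleton_left, mem_singleton]
      exact (hsm (i + 1) (j + 1) (by omega) (by omega)).ne
  · -- the profile vanishes off the levels
    refine hLa l hl fun j hj hlj => ?_
    rcases Nat.lt_or_ge j 2 with hj2 | hj2
    · refine hnot 0 (by omega) ?_
      rw [hS0, mem_insert, mem_singleton]
      interval_cases j
      · left; rw [hlj, ha0]
      · right; exact hlj
    · refine hnot (j - 1) (by omega) ?_
      rw [hSj (j - 1) (by omega), mem_singleton, hlj]
      congr 1; omega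
  · -- the youngest closure: (x_1 + x_(a_1))·(1 + κ_0) ≤ 0.8333·(1 + 6757∕36000) ≤ 1
    rw [hsum0]
    have := hXPc q
    have := hXP0 q
    have := (hκ0b q).1
    have := (hκ0b q).2
    nlinarith
  · rw [hsumj j q hj1]
    rcases Nat.lt_or_ge j 2 with hj2 | hj2
    · -- j = 1: the level {a_2} above the young pair: `row₃` at a′ = 58a_1, rescaled
      have hj : j = 1 := by omega
      subst hj
      have h2r : 2 < r := by omega
      have hκ0e : κ 0 q = 58 * (a 1 : ℝ) / (a 2 : ℝ) * G₃ (X 2 q) := by rw [hκ, if_pos rfl, if_pos h2r]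
      have ha1n : (0 : ℝ) ≤ (a 1 : ℝ) := Nat.cast_nonneg _
      have ha2p : (0 : ℝ) < (a 2 : ℝ) := by exact_mod_cast ha1' 2 h2r
      obtain ⟨h1, h2⟩ := row₃ hG₃ hM (a := (a 1 : ℝ)) (a' := 58 * (a 1 : ℝ)) ha1n (by positivity) le_rfl (hX0 2 q) (hXc 2 q le_rfl h2r)
        (hκ0 1 q) (hA 1 q le_rfl h2r)
      show X 2 q * (1 + κ 1 q) < 1 ∧ (a 1 : ℝ) * (4 * X 2 q * (1 + κ 1 q) + κ 1 q) ≤ κ 0 q * (1 - X 2 q * (1 + κ 1 q)) * (lo 1 : ℝ)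
      refine ⟨h1, ?_⟩
      have hlo1 : (lo 1 : ℝ) = (a 2 : ℝ) := by rw [hlo', if_neg one_ne_zero]
      have e1 : κ 0 q * (1 - X 2 q * (1 + κ 1 q)) * (a 2 : ℝ) = G₃ (X 2 q) * (1 - X 2 q * (1 + κ 1 q)) * (58 * (a 1 : ℝ)) := by
        rw [hκ0e]; field_simp
      rw [hlo1, e1]; exact h2
    · -- j ≥ 2: tower levels {a_(j+1)} above {a_j}: `tower_closure`
      have hjm : j - 1 + 1 = j := by omega
      have hjm2 : j - 1 + 2 = j + 1 := by omega
      have h16 : 16 * a j ≤ a (j + 1) := haR j hj2 (by omega)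
      have hlo_j : (lo j : ℝ) = (a (j + 1) : ℝ) := by rw [hlo', if_neg (by omega)]
      rw [hlo_j, hjm]
      exact tower_closure hG₁ hG₂ hG₃ hM h16 (hX0 (j + 1) q) (hXc (j + 1) q (by omega) (by omega)) (hκ0 j q) (hA j q (by omega) (by omega))
        (by rw [hκ, if_neg (by omega), if_pos (by omega), hjm, hjm2, hT])

/-! ## §3 The union: every young second age -/

/-- **THE CENSUS TOWER AT RATIO SIXTEEN FOR EVERY YOUNG SECOND AGE.**  Ages `a_0 = 1 < a_1 < a_2 < …` (`r ≥ 1`) with `2 ≤ a_1`, `72a_1 ≤ a_2`,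
`16a_j ≤ a_{j+1}` (`j ≥ 2`), all `< K`, the profile vanishing off them: `0 ≤ ε ≤ e` at every pin — (E106d) for `a_1 ≥ 58`, §1 for `30 ≤ a_1 < 58`,
§2 for `a_1 ≤ 29`. [folklore] -/
theorem flow_nonneg_census_tower16_every
    (hmono : ∀ u v : ℕ → ℝ, SeqBox γ u → SeqBox γ v → (∀ j, u j ≤ v j) → B u ≤ B v)
    (hL : ∀ k, 0 ≤ L k) (hb : 0 < b) (hlo : ∀ u, SeqBox γ u → b ≤ B u) (hdom : ∀ u, SeqBox γ u → ∑ k ∈ range K, L k * u k ≤ B u)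
    (hh : SeqBox γ h) (hf : MemFlow B gIR h) (hg : ∀ t, 0 < g t ∧ g t ≤ 1)
    (hgF : ∀ t, 1 ≤ g t * (1 + ∑ k ∈ range K, L k * h (t + k) ^ 3 / 2))
    {r : ℕ} {a : ℕ → ℕ} (hr : 1 ≤ r) (ha0 : a 0 = 1) (ha1 : 1 < r → 2 ≤ a 1) (ha2 : 2 < r → 72 * a 1 ≤ a 2)
    (haR : ∀ j, 2 ≤ j → j + 1 < r → 16 * a j ≤ a (j + 1)) (haK : ∀ j, j < r → a j < K)
    (hLa : ∀ l, l < K → (∀ j, j < r → l ≠ a j) → L l = 0)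
    {N : ℕ} {KL : ℕ → ℕ → ℕ → ℝ}
    (hKL : ∀ k n l, KL k n l = if 0 < k ∧ k < K ∧ l < k then L k * h (n + k) ^ 3 / 2 * ∏ t ∈ Ico (n + 1 + l) (n + k + 1), g t else 0)
    {KA : ℕ → ℕ → ℕ → ℝ} {RA : ℕ → (ℕ → ℝ) → ℕ → ℝ}
    (hRA : ∀ i v m, RA i v m = ∑ l ∈ range K, KA i m l * v (m + 1 + l))
    (hKA : ∀ i m l, KA i m l = KL i m l + KA (i + 1) m l) (hKAtop : ∀ m l, KA K m l = 0)
    {e ε : ℕ → ℝ} (he0 : ∀ m, 0 ≤ e m) (hea : ∀ m, e (m + 1) ≤ e m)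
    (hεt : ∀ m, N < m → ε m = 0) (hεrec : ∀ m, ε m = e m - RA 1 ε m) : ∀ m, 0 ≤ ε m ∧ ε m ≤ e m := by
  rcases Nat.lt_or_ge 1 r with h1r | h1r
  · rcases le_or_gt 58 (a 1) with h58 | h58
    · refine flow_nonneg_census_tower16 hmono hL hb hlo hdom hh hf hg hgF hr ha0 (fun _ => h58) (fun j hj hjr => ?_) haK hLa hKL hRA hKA hKAtop
        he0 hea hεt hεrec
      rcases Nat.lt_or_ge j 2 with hj2 | hj2
      · have hj : j = 1 := by omega
        subst hj; show 16 * a 1 ≤ a 2; have := ha2 hjr; omega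
      · exact haR j hj2 hjr
    rcases le_or_gt 30 (a 1) with h30 | h30
    · exact flow_nonneg_census_tower16_mid hmono hL hb hlo hdom hh hf hg hgF hr ha0 (fun _ => h30) ha2 haR haK hLa hKL hRA hKA hKAtop
        he0 hea hεt hεrec
    · exact flow_nonneg_census_tower16_young_pair hmono hL hb hlo hdom hh hf hg hgF h1r ha0 (ha1 h1r) (by omega) ha2 haR haK hLa hKL hRA hKA
        hKAtop he0 hea hεt hεrec
  · exact flow_nonneg_census_tower16_mid hmono hL hb hlo hdom hh hf hg hgF hr ha0 (fun h => absurd h (by omega)) (fun h => absurd h (by omega))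
      haR haK hLa hKL hRA hKA hKAtop he0 hea hεt hεrec

end Summit.QuantumFields.BalabanUV.Beta.EriceRemainderEnclosureHistoryAutonomyComparisonAgeCompositionTower16Every
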